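import Summits.QuantumFields.BalabanUV.T4Continuum.Support.NE7OpenOfMinimisation
import Summits.QuantumFields.BalabanUV.T4Continuum.Support.NE7OneStepGenericSlicePath
import Summits.QuantumFields.BalabanUV.T4Continuum.Support.NE7OneStepOfSectorOpen
import HarnessLib

/-!
# NE7OneStepGenericSliceSector — F28 (`NE7OneStepOfSectorApeRep`, the END of gen 68: ONE-STEP ⇐ (APE)^path ∧ (REP^gauge)^path for every small sector datum) OVER AN
# ABSTRACT SLICE FAMILY `𝒯 k W`, and its SU(2) `d = 4` `L = 2` END for the corner-free slice `𝒯_E = energyBlockLandauW` — file 6 of the END re-thread (memo ROAD-G99 §3.5 ∕ §3.8 (C))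
Cell `pub-balaban`, sub-cell t4, lineage `b2b-balaban-t4-ne7-p1`, generation 99 (CRUX PROVER NE7 #1 = OWNER of BINDER row NE7); over gen 99's `NE7ConvOneStepGenericSliceTangent` (p755239)
and `NE7OneStepGenericSlicePath` (p755557), F27 `NE7OpenOfMinimisation.hopen_of_ape_allSmall`, F21 ∕ F22's paths and global gauge (all slice-free).
WHY ∕ WHAT ([folklore] composition; 0 def, 0 sorry).  F28 hardcodes `X_T ∈ T_♮(U♯) = frameFreeBlockLandauW L N (k+1) U♯`; the Bałaban-slice road runs the same composition over
`𝒯_E(U♯)`; as in files 1–5 the re-issue is GENERIC in `𝒯 : ℕ → cfg → Set dir` with (hT) «tangent-critical ⟹ critical on `𝒯 j W`» and (hP) «class SlicePoincare for `𝒯 j W`»,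
proofs of record verbatim with F26 ∕ F20 replaced by their generic re-issues: **`oneStep_of_path_ape_rep_generic_gauge`** (any data path), **`oneStep_of_path_apeMin_rep_generic_gauge`**
((APE) of global minimisers only), **`oneStep_of_expChart_ape_rep_generic_gauge`** (`V = W e^{A}`), **`oneStep_of_sector_ape_rep_generic_gauge`** (`d = 4`, every sector datum through
the global gauge), and the SU(2) END **`oneStep_SU2_of_sector_ape_repE_gauge`** (`L = 2`, `card n = 2`, `0 < ε ≤ 10⁻⁵³`, `𝒯_E`, (hT) by `hT_energyBlockLandau`, (hP) by
`classSlicePoincare_energyBlockLandau_SU2`, constant `8·CPLine 4 2 2 10⁻¹⁷ 10⁻⁵³ + 1`, level family and class smallness DISCHARGED): the ONE-STEP binder of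
`NE7InteriorInduction.interior_exists_all_levels` follows from TWO displayed letters along the data path — (APE)^path (the a-priori estimate with margin, [Balaban1985Variational]
Sect. F TYPE) and (REP^gauge over `𝒯`)^path (every admissible, small, tangent-critical `U♯` represents every admissible `U′` as `U′^u = U♯e^{X}`, `X = X_T + X_N`, `X_T ∈ 𝒯 k U♯`,
F9's weighted letters under the STRICT k-free line; [Balaban1985Variational] Prop. 2 ∕ B8 Thm 2 TYPE) — for `𝒯_E` exactly what the supplier of memo §3.8 (B) must deliver.
HONEST FRAMING (page 1).  Composition; the two letters carry ALL the analysis and are asserted for nothing; NOT ONE-STEP, NOT NE7; spine 0∕9; finite T⁴ rung (B)+1 — NOT infinite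
volume, NOT mass gap, NOT BetaPertH, NOT Clay.  Continuum YM on T⁴ ⇐ BetaPertH ∧ nine spine estimates (0/9 proved); BetaPertH ⇐ (D1) ∧ (D4) ∧ CAP+tail; G-an2-4 gates asym, D1, NE2/3/4.
-/

set_option autoImplicit false
open scoped BigOperators Matrix Matrix.Norms.L2Operator Topology
open NormedSpace Finset Set Filter

namespace Summit.QuantumFields.BalabanUV.T4Continuum.NE7OneStepGenericSliceSector
open Literature.MathematicalPhysics.QuantumFieldTheory.Balaban1983to89
open B7Prop1Explicit B7Prop2Explicit MatrixLog UnitaryModel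
open T4AveragingDeficitWall (IsUnitaryCfg IsSkewDir SmallField vary curl curlSq dirSq flat_mem_classes Plaq)
open T4AveragingDeficitWallBoundary (IsPeriodicCfg periodBox)
open AveragingDeficitPeriodicCounting (IsPeriodicDir)
open AveragingDeficitPlaqDeriv (vary_isUnitaryCfg)
open AveragingDeficitMultiLevelPrep (tower LevelSmall TangentIter)
open MinimalActionLevels (levelAction perWin)
open MinimalActionSandwich (IsMinimiser admissible)
open MinimalActionRate (sfClass)
open MinimalActionWitness (flatCfg)
open NE3HessForm (dAction)
open NE3SlicePoincareShape (SlicePoincare slicePoincare_mono)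
open NE3EnergyWeightedShapes (energyNormW)
open NE3SlicePoincareBudgetLine (CPLine)
open NE3EnergyShapes (IsUnitarySite IsPeriodicSite)
open NE3ClassRadiusFamily (CPLine_nonneg_d4_L2)
open NE7ConvOneStepSU2 (levelSmall_all_d4_L2)
open TorusSmallFieldGlobalGauge (sectorConst gaugeConst)
open NE7PushForwardContinuity (isSkewDir_smul)
open NE7OneStepOfPathOpen (flatCfg_mem_admissible classSmall_d4_L2)
open NE7DataPathExp (continuous_expPath expPath_zero expPath_one oneStep_of_expChart_open_repW)
open NE7DataExpChartGlobalGauge (exists_expChart_of_sector oneStep_of_oneStep_gaugeAct)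
open NE7EtaMinimiserGaugeCovariance (levelAction_gaugeAct)
open BlockAverageCurrent (smallField_gaugeAct)
open NE7ConvOneStepGenericSliceTangent (allSmall_of_tanCritical_rep_generic_gauge isMinimiser_of_tanCritical_rep_generic_gauge)
open NE7OneStepGenericSlicePath (oneStep_of_path_open_rep_generic)
open NE7MeanZeroGaugeSliceW (energyBlockLandauW)
open NE7EnergyBlockLandauClassPoincare (classSlicePoincare_energyBlockLandau_SU2)
open NE7ConvOneStepGenericSlice (hT_energyBlockLandau)
open NE7OpenOfMinimisation (hopen_of_ape_allSmall exists_minimiser_small_near tanCritical_of_isMinimiser)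

noncomputable section

variable {d : ℕ} {n : Type*} [Fintype n] [DecidableEq n]

/-! ## §1 ONE-STEP along an arbitrary data path from (APE)^path ∧ (REP^gauge over `𝒯`)^path -/

/-- **ONE-STEP ⇐ (APE)^path ∧ (REP^gauge over `𝒯`)^path ALONG AN ARBITRARY DATA PATH** (generic `d`, `L ≥ 2`, `N ≥ 1`): `γ` continuous on `[0,1]` with unitary
`N`-periodic values, `γ 0` carrying at every level an admissible configuration with all plaquettes `1`, `γ 1 = V`; radii `0 ≤ δ₁ < δ < ε`; class smallness,
the `LevelSmall` family and (hT), (hP) with constant `CP` as in `NE7OneStepGenericSlicePath`.  The two letters are asked at the data `γ τ`, `τ ∈ [0,1]` (F20's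
`NE7OneStepGenericSlicePath.oneStep_of_path_open_rep_generic` with its `hopen` DERIVED).  Which path is used is the caller's business — its data must admit small admissible configurations for
the letters to be informative (memo H12 §3, refuter N-43-5).  [folklore] -/
theorem oneStep_of_path_ape_rep_generic_gauge [Nonempty n] {L N : ℕ} [NeZero L] [NeZero N] (hL : 2 ≤ L) (hN : 1 ≤ N) {ε δ δ₁ CP : ℝ} (hε0 : 0 ≤ ε)
    (hε1 : 16 * C0 d * ε ≤ 3) (hε2 : 1024 * (d + 1) * (d + 4) * (L : ℝ) ^ 2 * ε ≤ 1) (hδ₁ : 0 ≤ δ₁) (hδ₁δ : δ₁ < δ) (hδε : δ < ε) (hCP : 0 < CP)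
    (hls : ∀ k : ℕ, LevelSmall d L k (ε / ((L : ℝ) ^ (k + 1)) ^ 2))
    (𝒯 : ℕ → (Site d → Fin d → (Matrix n n ℂ)ˣ) → Set (Site d → Fin d → Matrix n n ℂ))
    (hT : ∀ (j : ℕ) (W : Site d → Fin d → (Matrix n n ℂ)ˣ), W ∈ sfClass d L N ε (j + 1) → ∀ F : Finset (Plaq d),
      (∀ φ : Site d → Fin d → Matrix n n ℂ, IsSkewDir φ → IsPeriodicDir φ ((tower L N (j + 1) : ℕ) : ℤ) → TangentIter L j W φ → dAction W φ F = 0) →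
      ∀ Y ∈ 𝒯 j W, dAction W Y F = 0)
    (hP : ∀ (j : ℕ) (W : Site d → Fin d → (Matrix n n ℂ)ˣ), W ∈ sfClass d L N ε (j + 1) →
      SlicePoincare L (j + 1) W (𝒯 j W) CP (periodBox (d := d) (N * L ^ (j + 1))))
    {V : Site d → Fin d → (Matrix n n ℂ)ˣ} (γ : ℝ → (Site d → Fin d → (Matrix n n ℂ)ˣ)) (hγc : ContinuousOn γ (Icc (0 : ℝ) 1))
    (hγu : ∀ τ ∈ Icc (0 : ℝ) 1, IsUnitaryCfg (γ τ)) (hγP : ∀ τ ∈ Icc (0 : ℝ) 1, IsPeriodicCfg (γ τ) (N : ℤ))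
    (h0 : ∀ k : ℕ, ∃ U₀ : Site d → Fin d → (Matrix n n ℂ)ˣ, U₀ ∈ admissible (sfClass d L N ε) L (k + 1) (γ 0) ∧ SmallField U₀ 0) (hγ1 : γ 1 = V)
    (hape : ∀ (k : ℕ), ∀ τ ∈ Icc (0 : ℝ) 1, ∀ U ∈ admissible (sfClass d L N ε) L (k + 1) (γ τ),
      SmallField U (δ / ((L : ℝ) ^ (k + 1)) ^ 2) →
      (∀ φ : Site d → Fin d → Matrix n n ℂ, IsSkewDir φ → IsPeriodicDir φ ((N * L ^ (k + 1) : ℕ) : ℤ) → TangentIter L k U φ →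
        dAction U φ (perWin d (N * L ^ (k + 1))) = 0) → SmallField U (δ₁ / ((L : ℝ) ^ (k + 1)) ^ 2))
    (hrep : ∀ (k : ℕ), ∀ τ ∈ Icc (0 : ℝ) 1, ∀ Us ∈ admissible (sfClass d L N ε) L (k + 1) (γ τ),
      SmallField Us (δ₁ / ((L : ℝ) ^ (k + 1)) ^ 2) →
      (∀ φ : Site d → Fin d → Matrix n n ℂ, IsSkewDir φ → IsPeriodicDir φ ((N * L ^ (k + 1) : ℕ) : ℤ) → TangentIter L k Us φ →
        dAction Us φ (perWin d (N * L ^ (k + 1))) = 0) →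
      ∀ U' ∈ admissible (sfClass d L N ε) L (k + 1) (γ τ), ∃ (u : Site d → (Matrix n n ℂ)ˣ) (X XT XN : Site d → Fin d → Matrix n n ℂ)
        (α ν κ₁ : ℝ), IsUnitarySite u ∧ IsSkewDir X ∧ IsPeriodicDir X ((N * L ^ (k + 1) : ℕ) : ℤ) ∧ 0 ≤ α ∧ (∀ x μ, ‖X x μ‖ ≤ α) ∧
        gaugeAct u U' = vary Us X 1 ∧
        X = XT + XN ∧ XT ∈ 𝒯 k Us ∧ IsSkewDir XN ∧ 0 ≤ ν ∧
        energyNormW L (k + 1) Us XN (periodBox (d := d) (N * L ^ (k + 1)))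
          ≤ ν * energyNormW L (k + 1) Us X (periodBox (d := d) (N * L ^ (k + 1))) ∧
        ε / ((L : ℝ) ^ (k + 1)) ^ 2 * (∑ p ∈ perWin d (N * L ^ (k + 1)), ‖curl Us XN p‖)
          ≤ κ₁ * energyNormW L (k + 1) Us X (periodBox (d := d) (N * L ^ (k + 1))) ^ 2 ∧
        2 * κ₁ < ((((1 / 2 - ν ^ 2) / (2 * (1 + CP)) - ν ^ 2) / 2
            - 576 * d * (Real.exp α - 1) ^ 2 * ((L : ℝ) ^ (k + 1)) ^ 2) / (Fintype.card n : ℝ)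
            - 28 * d * (ε / ((L : ℝ) ^ (k + 1)) ^ 2 + 7 * α ^ 2) * ((L : ℝ) ^ (k + 1)) ^ 2)) :
    ∀ (k : ℕ) (U₀ : Site d → Fin d → (Matrix n n ℂ)ˣ), U₀ ∈ admissible (sfClass d L N ε) L (k + 1) V →
      SmallField U₀ (δ / ((L : ℝ) ^ k) ^ 2) →
      ∃ U, IsMinimiser d (sfClass d L N ε) L N (k + 1) V U ∧ SmallField U (δ / ((L : ℝ) ^ (k + 1)) ^ 2) := by
  have hL1 : 1 ≤ L := by omega
  have hδ : 0 ≤ δ := hδ₁.trans hδ₁δ.le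
  have hLpos : ∀ k : ℕ, (0 : ℝ) < ((L : ℝ) ^ (k + 1)) ^ 2 := fun k => by positivity
  have hall : ∀ (k : ℕ), ∀ τ ∈ Icc (0 : ℝ) 1, ∀ U₀ ∈ admissible (sfClass d L N ε) L (k + 1) (γ τ), SmallField U₀ (δ₁ / ((L : ℝ) ^ (k + 1)) ^ 2) →
      (∀ φ : Site d → Fin d → Matrix n n ℂ, IsSkewDir φ → IsPeriodicDir φ ((N * L ^ (k + 1) : ℕ) : ℤ) → TangentIter L k U₀ φ →
        dAction U₀ φ (perWin d (N * L ^ (k + 1))) = 0) →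
      ∀ U ∈ admissible (sfClass d L N ε) L (k + 1) (γ τ), levelAction d L N (k + 1) U ≤ levelAction d L N (k + 1) U₀ →
        SmallField U (δ₁ / ((L : ℝ) ^ (k + 1)) ^ 2) :=
    fun k τ hτ U₀ hU₀ hU₀r₁ hcrit => allSmall_of_tanCritical_rep_generic_gauge hL1 hN hε0 hCP 𝒯 hT hP hU₀ hcrit (hrep k τ hτ U₀ hU₀ hU₀r₁ hcrit) hU₀r₁
  have hopen : ∀ (k : ℕ), ∀ τ₀ ∈ Icc (0 : ℝ) 1,
      (∃ U : Site d → Fin d → (Matrix n n ℂ)ˣ, U ∈ admissible (sfClass d L N ε) L (k + 1) (γ τ₀) ∧ SmallField U (δ / ((L : ℝ) ^ (k + 1)) ^ 2) ∧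
        ∀ φ : Site d → Fin d → Matrix n n ℂ, IsSkewDir φ → IsPeriodicDir φ ((N * L ^ (k + 1) : ℕ) : ℤ) → TangentIter L k U φ →
          dAction U φ (perWin d (N * L ^ (k + 1))) = 0) →
      ∃ ρ : ℝ, 0 < ρ ∧ ∀ τ ∈ Icc (0 : ℝ) 1, |τ - τ₀| < ρ →
        ∃ U : Site d → Fin d → (Matrix n n ℂ)ˣ, U ∈ admissible (sfClass d L N ε) L (k + 1) (γ τ) ∧ SmallField U (δ / ((L : ℝ) ^ (k + 1)) ^ 2) ∧
          ∀ φ : Site d → Fin d → Matrix n n ℂ, IsSkewDir φ → IsPeriodicDir φ ((N * L ^ (k + 1) : ℕ) : ℤ) → TangentIter L k U φ →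
            dAction U φ (perWin d (N * L ^ (k + 1))) = 0 := by
    intro k
    have hr₁ : 0 ≤ δ₁ / ((L : ℝ) ^ (k + 1)) ^ 2 := div_nonneg hδ₁ (hLpos k).le
    have hr₁r : δ₁ / ((L : ℝ) ^ (k + 1)) ^ 2 < δ / ((L : ℝ) ^ (k + 1)) ^ 2 := div_lt_div_of_pos_right hδ₁δ (hLpos k)
    have hrε : δ / ((L : ℝ) ^ (k + 1)) ^ 2 < ε / ((L : ℝ) ^ (k + 1)) ^ 2 := div_lt_div_of_pos_right hδε (hLpos k)
    exact hopen_of_ape_allSmall hL hN hε0 hε1 hε2 (hls k) hr₁ hr₁r hrε γ hγc hγu hγP (hape k) (hall k)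
  have h1I : (1 : ℝ) ∈ Icc (0 : ℝ) 1 := ⟨zero_le_one, le_rfl⟩
  have hrepU : ∀ (k : ℕ) (Us : Site d → Fin d → (Matrix n n ℂ)ˣ), Us ∈ admissible (sfClass d L N ε) L (k + 1) V →
      SmallField Us (δ / ((L : ℝ) ^ (k + 1)) ^ 2) →
      (∀ φ : Site d → Fin d → Matrix n n ℂ, IsSkewDir φ → IsPeriodicDir φ ((N * L ^ (k + 1) : ℕ) : ℤ) → TangentIter L k Us φ →
        dAction Us φ (perWin d (N * L ^ (k + 1))) = 0) →
      ∀ U' ∈ admissible (sfClass d L N ε) L (k + 1) V, ∃ (X XT XN : Site d → Fin d → Matrix n n ℂ) (α ν κ₁ : ℝ),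
        IsSkewDir X ∧ IsPeriodicDir X ((N * L ^ (k + 1) : ℕ) : ℤ) ∧ 0 ≤ α ∧ (∀ x μ, ‖X x μ‖ ≤ α) ∧
        levelAction d L N (k + 1) (vary Us X 1) ≤ levelAction d L N (k + 1) U' ∧
        SmallField (vary Us X 1) (ε / ((L : ℝ) ^ (k + 1)) ^ 2) ∧
        X = XT + XN ∧ XT ∈ 𝒯 k Us ∧ IsSkewDir XN ∧ 0 ≤ ν ∧
        energyNormW L (k + 1) Us XN (periodBox (d := d) (N * L ^ (k + 1)))
          ≤ ν * energyNormW L (k + 1) Us X (periodBox (d := d) (N * L ^ (k + 1))) ∧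
        ε / ((L : ℝ) ^ (k + 1)) ^ 2 * (∑ p ∈ perWin d (N * L ^ (k + 1)), ‖curl Us XN p‖)
          ≤ κ₁ * energyNormW L (k + 1) Us X (periodBox (d := d) (N * L ^ (k + 1))) ^ 2 ∧
        2 * κ₁ ≤ ((((1 / 2 - ν ^ 2) / (2 * (1 + CP)) - ν ^ 2) / 2
            - 576 * d * (Real.exp α - 1) ^ 2 * ((L : ℝ) ^ (k + 1)) ^ 2) / (Fintype.card n : ℝ)
            - 28 * d * (ε / ((L : ℝ) ^ (k + 1)) ^ 2 + 7 * α ^ 2) * ((L : ℝ) ^ (k + 1)) ^ 2) := by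
    intro k Us hUs hUsδ hcrit U' hU'
    rw [← hγ1] at hUs hU'
    have hUsδ₁ := hape k 1 h1I Us hUs hUsδ hcrit
    obtain ⟨u, X, XT, XN, α, ν, κ₁, hu, hXs, hXP, hα, hXα, hgauge, hsplit, hXT, hXNs, hν, hNw, hN1, hline⟩ :=
      hrep k 1 h1I Us hUs hUsδ₁ hcrit U' hU'
    refine ⟨X, XT, XN, α, ν, κ₁, hXs, hXP, hα, hXα, ?_, ?_, hsplit, hXT, hXNs, hν, hNw, hN1, hline.le⟩
    · rw [← hgauge, levelAction_gaugeAct]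
    · rw [← hgauge]
      exact smallField_gaugeAct hu hU'.1.2.2
  exact oneStep_of_path_open_rep_generic hL hN hε0 hε1 hε2 hδ hCP hls 𝒯 hT hP γ hγc h0 hγ1 hopen hrepU

/-! ## §1bis The variant with (APE) asked of GLOBAL MINIMISERS only (REP^gauge over `𝒯` then at the working radius `δ`), arbitrary path -/

/-- **ONE-STEP ⇐ (APE_min)^path ∧ (REP^gauge over `𝒯`)^path ALONG AN ARBITRARY DATA PATH** — the same END with the a-priori letter WEAKENED to global minimisers: (APE_min) «at every level and every
datum `γ τ` of the path, a GLOBAL MINIMISER that is `SmallField · (δ(L^{k+1})^{−2})` (and tangent-critical) is `SmallField · (δ₁(L^{k+1})^{−2})`»; in exchange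
REP^gauge over `𝒯` is asked over every admissible, `SmallField · (δ(L^{k+1})^{−2})`, tangent-critical `U♯` (radius `δ` instead of `δ₁`).  Order of use at `τ₀`: the small
tangent-critical `U₀` is a minimiser by CONV from the gauge form (`isMinimiser_of_tanCritical_rep_generic_gauge`), then (APE_min), then ALL-SMALL (F26), then F27's
`exists_minimiser_small_near` and Fermat. [folklore] -/
theorem oneStep_of_path_apeMin_rep_generic_gauge [Nonempty n] {L N : ℕ} [NeZero L] [NeZero N] (hL : 2 ≤ L) (hN : 1 ≤ N) {ε δ δ₁ CP : ℝ} (hε0 : 0 ≤ ε)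
    (hε1 : 16 * C0 d * ε ≤ 3) (hε2 : 1024 * (d + 1) * (d + 4) * (L : ℝ) ^ 2 * ε ≤ 1) (hδ₁ : 0 ≤ δ₁) (hδ₁δ : δ₁ < δ) (hδε : δ < ε) (hCP : 0 < CP)
    (hls : ∀ k : ℕ, LevelSmall d L k (ε / ((L : ℝ) ^ (k + 1)) ^ 2))
    (𝒯 : ℕ → (Site d → Fin d → (Matrix n n ℂ)ˣ) → Set (Site d → Fin d → Matrix n n ℂ))
    (hT : ∀ (j : ℕ) (W : Site d → Fin d → (Matrix n n ℂ)ˣ), W ∈ sfClass d L N ε (j + 1) → ∀ F : Finset (Plaq d),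
      (∀ φ : Site d → Fin d → Matrix n n ℂ, IsSkewDir φ → IsPeriodicDir φ ((tower L N (j + 1) : ℕ) : ℤ) → TangentIter L j W φ → dAction W φ F = 0) →
      ∀ Y ∈ 𝒯 j W, dAction W Y F = 0)
    (hP : ∀ (j : ℕ) (W : Site d → Fin d → (Matrix n n ℂ)ˣ), W ∈ sfClass d L N ε (j + 1) →
      SlicePoincare L (j + 1) W (𝒯 j W) CP (periodBox (d := d) (N * L ^ (j + 1))))
    {V : Site d → Fin d → (Matrix n n ℂ)ˣ} (γ : ℝ → (Site d → Fin d → (Matrix n n ℂ)ˣ)) (hγc : ContinuousOn γ (Icc (0 : ℝ) 1))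
    (hγu : ∀ τ ∈ Icc (0 : ℝ) 1, IsUnitaryCfg (γ τ)) (hγP : ∀ τ ∈ Icc (0 : ℝ) 1, IsPeriodicCfg (γ τ) (N : ℤ))
    (h0 : ∀ k : ℕ, ∃ U₀ : Site d → Fin d → (Matrix n n ℂ)ˣ, U₀ ∈ admissible (sfClass d L N ε) L (k + 1) (γ 0) ∧ SmallField U₀ 0) (hγ1 : γ 1 = V)
    (hape : ∀ (k : ℕ), ∀ τ ∈ Icc (0 : ℝ) 1, ∀ U : Site d → Fin d → (Matrix n n ℂ)ˣ, IsMinimiser d (sfClass d L N ε) L N (k + 1) (γ τ) U →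
      SmallField U (δ / ((L : ℝ) ^ (k + 1)) ^ 2) →
      (∀ φ : Site d → Fin d → Matrix n n ℂ, IsSkewDir φ → IsPeriodicDir φ ((N * L ^ (k + 1) : ℕ) : ℤ) → TangentIter L k U φ →
        dAction U φ (perWin d (N * L ^ (k + 1))) = 0) → SmallField U (δ₁ / ((L : ℝ) ^ (k + 1)) ^ 2))
    (hrep : ∀ (k : ℕ), ∀ τ ∈ Icc (0 : ℝ) 1, ∀ Us ∈ admissible (sfClass d L N ε) L (k + 1) (γ τ),
      SmallField Us (δ / ((L : ℝ) ^ (k + 1)) ^ 2) →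
      (∀ φ : Site d → Fin d → Matrix n n ℂ, IsSkewDir φ → IsPeriodicDir φ ((N * L ^ (k + 1) : ℕ) : ℤ) → TangentIter L k Us φ →
        dAction Us φ (perWin d (N * L ^ (k + 1))) = 0) →
      ∀ U' ∈ admissible (sfClass d L N ε) L (k + 1) (γ τ), ∃ (u : Site d → (Matrix n n ℂ)ˣ) (X XT XN : Site d → Fin d → Matrix n n ℂ)
        (α ν κ₁ : ℝ), IsUnitarySite u ∧ IsSkewDir X ∧ IsPeriodicDir X ((N * L ^ (k + 1) : ℕ) : ℤ) ∧ 0 ≤ α ∧ (∀ x μ, ‖X x μ‖ ≤ α) ∧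
        gaugeAct u U' = vary Us X 1 ∧
        X = XT + XN ∧ XT ∈ 𝒯 k Us ∧ IsSkewDir XN ∧ 0 ≤ ν ∧
        energyNormW L (k + 1) Us XN (periodBox (d := d) (N * L ^ (k + 1)))
          ≤ ν * energyNormW L (k + 1) Us X (periodBox (d := d) (N * L ^ (k + 1))) ∧
        ε / ((L : ℝ) ^ (k + 1)) ^ 2 * (∑ p ∈ perWin d (N * L ^ (k + 1)), ‖curl Us XN p‖)
          ≤ κ₁ * energyNormW L (k + 1) Us X (periodBox (d := d) (N * L ^ (k + 1))) ^ 2 ∧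
        2 * κ₁ < ((((1 / 2 - ν ^ 2) / (2 * (1 + CP)) - ν ^ 2) / 2
            - 576 * d * (Real.exp α - 1) ^ 2 * ((L : ℝ) ^ (k + 1)) ^ 2) / (Fintype.card n : ℝ)
            - 28 * d * (ε / ((L : ℝ) ^ (k + 1)) ^ 2 + 7 * α ^ 2) * ((L : ℝ) ^ (k + 1)) ^ 2)) :
    ∀ (k : ℕ) (U₀ : Site d → Fin d → (Matrix n n ℂ)ˣ), U₀ ∈ admissible (sfClass d L N ε) L (k + 1) V →
      SmallField U₀ (δ / ((L : ℝ) ^ k) ^ 2) →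
      ∃ U, IsMinimiser d (sfClass d L N ε) L N (k + 1) V U ∧ SmallField U (δ / ((L : ℝ) ^ (k + 1)) ^ 2) := by
  have hL1 : 1 ≤ L := by omega
  have hδ : 0 ≤ δ := hδ₁.trans hδ₁δ.le
  have hLpos : ∀ k : ℕ, (0 : ℝ) < ((L : ℝ) ^ (k + 1)) ^ 2 := fun k => by positivity
  have hopen : ∀ (k : ℕ), ∀ τ₀ ∈ Icc (0 : ℝ) 1,
      (∃ U : Site d → Fin d → (Matrix n n ℂ)ˣ, U ∈ admissible (sfClass d L N ε) L (k + 1) (γ τ₀) ∧ SmallField U (δ / ((L : ℝ) ^ (k + 1)) ^ 2) ∧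
        ∀ φ : Site d → Fin d → Matrix n n ℂ, IsSkewDir φ → IsPeriodicDir φ ((N * L ^ (k + 1) : ℕ) : ℤ) → TangentIter L k U φ →
          dAction U φ (perWin d (N * L ^ (k + 1))) = 0) →
      ∃ ρ : ℝ, 0 < ρ ∧ ∀ τ ∈ Icc (0 : ℝ) 1, |τ - τ₀| < ρ →
        ∃ U : Site d → Fin d → (Matrix n n ℂ)ˣ, U ∈ admissible (sfClass d L N ε) L (k + 1) (γ τ) ∧ SmallField U (δ / ((L : ℝ) ^ (k + 1)) ^ 2) ∧
          ∀ φ : Site d → Fin d → Matrix n n ℂ, IsSkewDir φ → IsPeriodicDir φ ((N * L ^ (k + 1) : ℕ) : ℤ) → TangentIter L k U φ →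
            dAction U φ (perWin d (N * L ^ (k + 1))) = 0 := by
    intro k τ₀ hτ₀ h0'
    obtain ⟨U₀, hU₀, hU₀r, hcrit⟩ := h0'
    have hr₁r : δ₁ / ((L : ℝ) ^ (k + 1)) ^ 2 < δ / ((L : ℝ) ^ (k + 1)) ^ 2 := div_lt_div_of_pos_right hδ₁δ (hLpos k)
    have hrε : δ / ((L : ℝ) ^ (k + 1)) ^ 2 < ε / ((L : ℝ) ^ (k + 1)) ^ 2 := div_lt_div_of_pos_right hδε (hLpos k)
    have hrep₀ := hrep k τ₀ hτ₀ U₀ hU₀ hU₀r hcrit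
    have hmin₀ : IsMinimiser d (sfClass d L N ε) L N (k + 1) (γ τ₀) U₀ := isMinimiser_of_tanCritical_rep_generic_gauge hL1 hN hε0 hCP 𝒯 hT hP hU₀ hcrit hrep₀
    have hU₀r₁ : SmallField U₀ (δ₁ / ((L : ℝ) ^ (k + 1)) ^ 2) := hape k τ₀ hτ₀ U₀ hmin₀ hU₀r hcrit
    have hall₀ : ∀ U ∈ admissible (sfClass d L N ε) L (k + 1) (γ τ₀), levelAction d L N (k + 1) U ≤ levelAction d L N (k + 1) U₀ →
        SmallField U (δ₁ / ((L : ℝ) ^ (k + 1)) ^ 2) := allSmall_of_tanCritical_rep_generic_gauge hL1 hN hε0 hCP 𝒯 hT hP hU₀ hcrit hrep₀ hU₀r₁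
    obtain ⟨ρ, hρ, hnear⟩ := exists_minimiser_small_near hL hε0 hε1 hε2 (hls k) hr₁r (hr₁r.trans hrε) γ hγc hγu hγP hτ₀ hU₀ hU₀r₁ hall₀
    refine ⟨ρ, hρ, fun τ hτI hτρ => ?_⟩
    obtain ⟨⟨U, hU⟩, hsmall⟩ := hnear τ hτI hτρ
    have hUr : SmallField U (δ / ((L : ℝ) ^ (k + 1)) ^ 2) := hsmall U hU
    exact ⟨U, hU.mem, hUr, tanCritical_of_isMinimiser hL1 hN hU (div_nonneg hδ (hLpos k).le) hrε hUr (hls k)⟩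
  have hrepU : ∀ (k : ℕ) (Us : Site d → Fin d → (Matrix n n ℂ)ˣ), Us ∈ admissible (sfClass d L N ε) L (k + 1) V →
      SmallField Us (δ / ((L : ℝ) ^ (k + 1)) ^ 2) →
      (∀ φ : Site d → Fin d → Matrix n n ℂ, IsSkewDir φ → IsPeriodicDir φ ((N * L ^ (k + 1) : ℕ) : ℤ) → TangentIter L k Us φ →
        dAction Us φ (perWin d (N * L ^ (k + 1))) = 0) →
      ∀ U' ∈ admissible (sfClass d L N ε) L (k + 1) V, ∃ (X XT XN : Site d → Fin d → Matrix n n ℂ) (α ν κ₁ : ℝ),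
        IsSkewDir X ∧ IsPeriodicDir X ((N * L ^ (k + 1) : ℕ) : ℤ) ∧ 0 ≤ α ∧ (∀ x μ, ‖X x μ‖ ≤ α) ∧
        levelAction d L N (k + 1) (vary Us X 1) ≤ levelAction d L N (k + 1) U' ∧
        SmallField (vary Us X 1) (ε / ((L : ℝ) ^ (k + 1)) ^ 2) ∧
        X = XT + XN ∧ XT ∈ 𝒯 k Us ∧ IsSkewDir XN ∧ 0 ≤ ν ∧
        energyNormW L (k + 1) Us XN (periodBox (d := d) (N * L ^ (k + 1)))
          ≤ ν * energyNormW L (k + 1) Us X (periodBox (d := d) (N * L ^ (k + 1))) ∧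
        ε / ((L : ℝ) ^ (k + 1)) ^ 2 * (∑ p ∈ perWin d (N * L ^ (k + 1)), ‖curl Us XN p‖)
          ≤ κ₁ * energyNormW L (k + 1) Us X (periodBox (d := d) (N * L ^ (k + 1))) ^ 2 ∧
        2 * κ₁ ≤ ((((1 / 2 - ν ^ 2) / (2 * (1 + CP)) - ν ^ 2) / 2
            - 576 * d * (Real.exp α - 1) ^ 2 * ((L : ℝ) ^ (k + 1)) ^ 2) / (Fintype.card n : ℝ)
            - 28 * d * (ε / ((L : ℝ) ^ (k + 1)) ^ 2 + 7 * α ^ 2) * ((L : ℝ) ^ (k + 1)) ^ 2) := by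
    intro k Us hUs hUsδ hcrit U' hU'
    have h1I : (1 : ℝ) ∈ Icc (0 : ℝ) 1 := ⟨zero_le_one, le_rfl⟩
    rw [← hγ1] at hUs hU'
    obtain ⟨u, X, XT, XN, α, ν, κ₁, hu, hXs, hXP, hα, hXα, hgauge, hsplit, hXT, hXNs, hν, hNw, hN1, hline⟩ :=
      hrep k 1 h1I Us hUs hUsδ hcrit U' hU'
    refine ⟨X, XT, XN, α, ν, κ₁, hXs, hXP, hα, hXα, ?_, ?_, hsplit, hXT, hXNs, hν, hNw, hN1, hline.le⟩
    · rw [← hgauge, levelAction_gaugeAct]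
    · rw [← hgauge]
      exact smallField_gaugeAct hu hU'.1.2.2
  exact oneStep_of_path_open_rep_generic hL hN hε0 hε1 hε2 hδ hCP hls 𝒯 hT hP γ hγc h0 hγ1 hopen hrepU

/-! ## §1ter The exponential chart around a datum with flat lifts (F21's path) -/

/-- **ONE-STEP ⇐ (APE)^path ∧ (REP^gauge over `𝒯`)^path FOR DATA IN THE EXPONENTIAL CHART AROUND A DATUM WITH FLAT LIFTS** (generic `d`, `L ≥ 2`, `N ≥ 1`):
`V = W e^{A}`, `W` unitary `N`-periodic carrying at every level an admissible configuration with all plaquettes `1` (`W = flatCfg` qualifies), `A` skew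
`N`-periodic; radii `0 ≤ δ₁ < δ < ε`; class smallness, the `LevelSmall` family and (hT), (hP) with constant `CP` as in `NE7OneStepGenericSlicePath` ∕ F21.  See the module docstring for
the two letters.  [folklore] -/
theorem oneStep_of_expChart_ape_rep_generic_gauge [Nonempty n] {L N : ℕ} [NeZero L] [NeZero N] (hL : 2 ≤ L) (hN : 1 ≤ N) {ε δ δ₁ CP : ℝ} (hε0 : 0 ≤ ε)
    (hε1 : 16 * C0 d * ε ≤ 3) (hε2 : 1024 * (d + 1) * (d + 4) * (L : ℝ) ^ 2 * ε ≤ 1) (hδ₁ : 0 ≤ δ₁) (hδ₁δ : δ₁ < δ) (hδε : δ < ε) (hCP : 0 < CP)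
    (hls : ∀ k : ℕ, LevelSmall d L k (ε / ((L : ℝ) ^ (k + 1)) ^ 2))
    (𝒯 : ℕ → (Site d → Fin d → (Matrix n n ℂ)ˣ) → Set (Site d → Fin d → Matrix n n ℂ))
    (hT : ∀ (j : ℕ) (W : Site d → Fin d → (Matrix n n ℂ)ˣ), W ∈ sfClass d L N ε (j + 1) → ∀ F : Finset (Plaq d),
      (∀ φ : Site d → Fin d → Matrix n n ℂ, IsSkewDir φ → IsPeriodicDir φ ((tower L N (j + 1) : ℕ) : ℤ) → TangentIter L j W φ → dAction W φ F = 0) →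
      ∀ Y ∈ 𝒯 j W, dAction W Y F = 0)
    (hP : ∀ (j : ℕ) (W : Site d → Fin d → (Matrix n n ℂ)ˣ), W ∈ sfClass d L N ε (j + 1) →
      SlicePoincare L (j + 1) W (𝒯 j W) CP (periodBox (d := d) (N * L ^ (j + 1))))
    {W : Site d → Fin d → (Matrix n n ℂ)ˣ} (hWu : IsUnitaryCfg W) (hWP : IsPeriodicCfg W (N : ℤ)) {A : Site d → Fin d → Matrix n n ℂ}
    (hAs : IsSkewDir A) (hAP : IsPeriodicDir A (N : ℤ))
    (h0 : ∀ k : ℕ, ∃ U₀ : Site d → Fin d → (Matrix n n ℂ)ˣ, U₀ ∈ admissible (sfClass d L N ε) L (k + 1) W ∧ SmallField U₀ 0)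
    (hape : ∀ (k : ℕ), ∀ τ ∈ Icc (0 : ℝ) 1, ∀ U ∈ admissible (sfClass d L N ε) L (k + 1) (vary W (τ • A) 1),
      SmallField U (δ / ((L : ℝ) ^ (k + 1)) ^ 2) →
      (∀ φ : Site d → Fin d → Matrix n n ℂ, IsSkewDir φ → IsPeriodicDir φ ((N * L ^ (k + 1) : ℕ) : ℤ) → TangentIter L k U φ →
        dAction U φ (perWin d (N * L ^ (k + 1))) = 0) → SmallField U (δ₁ / ((L : ℝ) ^ (k + 1)) ^ 2))
    (hrep : ∀ (k : ℕ), ∀ τ ∈ Icc (0 : ℝ) 1, ∀ Us ∈ admissible (sfClass d L N ε) L (k + 1) (vary W (τ • A) 1),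
      SmallField Us (δ₁ / ((L : ℝ) ^ (k + 1)) ^ 2) →
      (∀ φ : Site d → Fin d → Matrix n n ℂ, IsSkewDir φ → IsPeriodicDir φ ((N * L ^ (k + 1) : ℕ) : ℤ) → TangentIter L k Us φ →
        dAction Us φ (perWin d (N * L ^ (k + 1))) = 0) →
      ∀ U' ∈ admissible (sfClass d L N ε) L (k + 1) (vary W (τ • A) 1), ∃ (u : Site d → (Matrix n n ℂ)ˣ) (X XT XN : Site d → Fin d → Matrix n n ℂ)
        (α ν κ₁ : ℝ), IsUnitarySite u ∧ IsSkewDir X ∧ IsPeriodicDir X ((N * L ^ (k + 1) : ℕ) : ℤ) ∧ 0 ≤ α ∧ (∀ x μ, ‖X x μ‖ ≤ α) ∧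
        gaugeAct u U' = vary Us X 1 ∧
        X = XT + XN ∧ XT ∈ 𝒯 k Us ∧ IsSkewDir XN ∧ 0 ≤ ν ∧
        energyNormW L (k + 1) Us XN (periodBox (d := d) (N * L ^ (k + 1)))
          ≤ ν * energyNormW L (k + 1) Us X (periodBox (d := d) (N * L ^ (k + 1))) ∧
        ε / ((L : ℝ) ^ (k + 1)) ^ 2 * (∑ p ∈ perWin d (N * L ^ (k + 1)), ‖curl Us XN p‖)
          ≤ κ₁ * energyNormW L (k + 1) Us X (periodBox (d := d) (N * L ^ (k + 1))) ^ 2 ∧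
        2 * κ₁ < ((((1 / 2 - ν ^ 2) / (2 * (1 + CP)) - ν ^ 2) / 2
            - 576 * d * (Real.exp α - 1) ^ 2 * ((L : ℝ) ^ (k + 1)) ^ 2) / (Fintype.card n : ℝ)
            - 28 * d * (ε / ((L : ℝ) ^ (k + 1)) ^ 2 + 7 * α ^ 2) * ((L : ℝ) ^ (k + 1)) ^ 2)) :
    ∀ (k : ℕ) (U₀ : Site d → Fin d → (Matrix n n ℂ)ˣ), U₀ ∈ admissible (sfClass d L N ε) L (k + 1) (vary W A 1) →
      SmallField U₀ (δ / ((L : ℝ) ^ k) ^ 2) →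
      ∃ U, IsMinimiser d (sfClass d L N ε) L N (k + 1) (vary W A 1) U ∧ SmallField U (δ / ((L : ℝ) ^ (k + 1)) ^ 2) := by
  have hγu : ∀ τ ∈ Icc (0 : ℝ) 1, IsUnitaryCfg ((fun τ : ℝ => vary W (τ • A) 1) τ) := fun τ _ => vary_isUnitaryCfg hWu (isSkewDir_smul τ hAs) 1
  have hγP : ∀ τ ∈ Icc (0 : ℝ) 1, IsPeriodicCfg ((fun τ : ℝ => vary W (τ • A) 1) τ) (N : ℤ) := fun τ _ =>
    NE3QuadRemainderTower.vary_add_period hWP (fun y i κ => by simp only [Pi.smul_apply, hAP y i κ]) 1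
  have h0' : ∀ k : ℕ, ∃ U₀ : Site d → Fin d → (Matrix n n ℂ)ˣ,
      U₀ ∈ admissible (sfClass d L N ε) L (k + 1) ((fun τ : ℝ => vary W (τ • A) 1) 0) ∧ SmallField U₀ 0 := by
    intro k; simpa only [expPath_zero] using h0 k
  exact oneStep_of_path_ape_rep_generic_gauge hL hN hε0 hε1 hε2 hδ₁ hδ₁δ hδε hCP hls 𝒯 hT hP (fun τ : ℝ => vary W (τ • A) 1) (continuous_expPath W A).continuousOn
    hγu hγP h0' (expPath_one W A) hape hrep

/-! ## §2 The programme's case `d = 4`: every sector datum, through the global gauge -/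

/-- **ONE-STEP ⇐ (APE)^path ∧ (REP^gauge over `𝒯`)^path FOR EVERY SECTOR DATUM** (`d = 4`, `L ≥ 2`): for a unitary `N`-periodic datum `V` with `SmallField V η` in the
sector `|n|·N²·η ≤ sectorConst n`, the ONE-STEP binder follows from the two letters of the module docstring, both stated in the global gauge `u` of F22
(`V^u = e^{A}`, `A` skew periodic, `‖A‖ ≤ gaugeConst n·(N⁻¹ + N·η)`), universally over such `(u, A)`, at every level, along the path `τ ↦ e^{τA}`. [folklore] -/
theorem oneStep_of_sector_ape_rep_generic_gauge [Nonempty n] {L N : ℕ} [NeZero L] [NeZero N] (hL : 2 ≤ L) (hN : 1 ≤ N) {ε δ δ₁ CP η : ℝ} (hε0 : 0 ≤ ε)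
    (hε1 : 16 * C0 4 * ε ≤ 3) (hε2 : 1024 * ((4 : ℕ) + 1) * ((4 : ℕ) + 4) * (L : ℝ) ^ 2 * ε ≤ 1) (hδ₁ : 0 ≤ δ₁) (hδ₁δ : δ₁ < δ) (hδε : δ < ε)
    (hCP : 0 < CP) (hls : ∀ k : ℕ, LevelSmall 4 L k (ε / ((L : ℝ) ^ (k + 1)) ^ 2))
    (𝒯 : ℕ → (Site 4 → Fin 4 → (Matrix n n ℂ)ˣ) → Set (Site 4 → Fin 4 → Matrix n n ℂ))
    (hT : ∀ (j : ℕ) (W : Site 4 → Fin 4 → (Matrix n n ℂ)ˣ), W ∈ sfClass 4 L N ε (j + 1) → ∀ F : Finset (Plaq 4),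
      (∀ φ : Site 4 → Fin 4 → Matrix n n ℂ, IsSkewDir φ → IsPeriodicDir φ ((tower L N (j + 1) : ℕ) : ℤ) → TangentIter L j W φ → dAction W φ F = 0) →
      ∀ Y ∈ 𝒯 j W, dAction W Y F = 0)
    (hP : ∀ (j : ℕ) (W : Site 4 → Fin 4 → (Matrix n n ℂ)ˣ), W ∈ sfClass 4 L N ε (j + 1) →
      SlicePoincare L (j + 1) W (𝒯 j W) CP (periodBox (d := 4) (N * L ^ (j + 1))))
    (hη : 0 ≤ η) (hsec : (Fintype.card n : ℝ) * (N : ℝ) ^ 2 * η ≤ sectorConst n)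
    {V : Site 4 → Fin 4 → (Matrix n n ℂ)ˣ} (hVu : IsUnitaryCfg V) (hVP : IsPeriodicCfg V (N : ℤ)) (hVη : SmallField V η)
    (hape : ∀ (u : Site 4 → (Matrix n n ℂ)ˣ) (A : Site 4 → Fin 4 → Matrix n n ℂ), IsUnitarySite u → IsPeriodicSite u (N : ℤ) → IsSkewDir A →
      IsPeriodicDir A (N : ℤ) → (∀ (x : Site 4) (κ : Fin 4), ‖A x κ‖ ≤ gaugeConst n * (((N : ℝ))⁻¹ + (N : ℝ) * η)) →
      gaugeAct u V = vary (flatCfg : Site 4 → Fin 4 → (Matrix n n ℂ)ˣ) A 1 →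
      ∀ (k : ℕ), ∀ τ ∈ Icc (0 : ℝ) 1, ∀ U ∈ admissible (sfClass 4 L N ε) L (k + 1) (vary flatCfg (τ • A) 1),
        SmallField U (δ / ((L : ℝ) ^ (k + 1)) ^ 2) →
        (∀ φ : Site 4 → Fin 4 → Matrix n n ℂ, IsSkewDir φ → IsPeriodicDir φ ((N * L ^ (k + 1) : ℕ) : ℤ) → TangentIter L k U φ →
          dAction U φ (perWin 4 (N * L ^ (k + 1))) = 0) → SmallField U (δ₁ / ((L : ℝ) ^ (k + 1)) ^ 2))
    (hrep : ∀ (u : Site 4 → (Matrix n n ℂ)ˣ) (A : Site 4 → Fin 4 → Matrix n n ℂ), IsUnitarySite u → IsPeriodicSite u (N : ℤ) → IsSkewDir A →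
      IsPeriodicDir A (N : ℤ) → (∀ (x : Site 4) (κ : Fin 4), ‖A x κ‖ ≤ gaugeConst n * (((N : ℝ))⁻¹ + (N : ℝ) * η)) →
      gaugeAct u V = vary (flatCfg : Site 4 → Fin 4 → (Matrix n n ℂ)ˣ) A 1 →
      ∀ (k : ℕ), ∀ τ ∈ Icc (0 : ℝ) 1, ∀ Us ∈ admissible (sfClass 4 L N ε) L (k + 1) (vary flatCfg (τ • A) 1),
        SmallField Us (δ₁ / ((L : ℝ) ^ (k + 1)) ^ 2) →
        (∀ φ : Site 4 → Fin 4 → Matrix n n ℂ, IsSkewDir φ → IsPeriodicDir φ ((N * L ^ (k + 1) : ℕ) : ℤ) → TangentIter L k Us φ →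
          dAction Us φ (perWin 4 (N * L ^ (k + 1))) = 0) →
        ∀ U' ∈ admissible (sfClass 4 L N ε) L (k + 1) (vary flatCfg (τ • A) 1), ∃ (u' : Site 4 → (Matrix n n ℂ)ˣ)
          (X XT XN : Site 4 → Fin 4 → Matrix n n ℂ) (α ν κ₁ : ℝ), IsUnitarySite u' ∧ IsSkewDir X ∧ IsPeriodicDir X ((N * L ^ (k + 1) : ℕ) : ℤ) ∧
          0 ≤ α ∧ (∀ x μ, ‖X x μ‖ ≤ α) ∧ gaugeAct u' U' = vary Us X 1 ∧
          X = XT + XN ∧ XT ∈ 𝒯 k Us ∧ IsSkewDir XN ∧ 0 ≤ ν ∧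
          energyNormW L (k + 1) Us XN (periodBox (d := 4) (N * L ^ (k + 1)))
            ≤ ν * energyNormW L (k + 1) Us X (periodBox (d := 4) (N * L ^ (k + 1))) ∧
          ε / ((L : ℝ) ^ (k + 1)) ^ 2 * (∑ p ∈ perWin 4 (N * L ^ (k + 1)), ‖curl Us XN p‖)
            ≤ κ₁ * energyNormW L (k + 1) Us X (periodBox (d := 4) (N * L ^ (k + 1))) ^ 2 ∧
          2 * κ₁ < ((((1 / 2 - ν ^ 2) / (2 * (1 + CP)) - ν ^ 2) / 2
              - 576 * (4 : ℕ) * (Real.exp α - 1) ^ 2 * ((L : ℝ) ^ (k + 1)) ^ 2) / (Fintype.card n : ℝ)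
              - 28 * (4 : ℕ) * (ε / ((L : ℝ) ^ (k + 1)) ^ 2 + 7 * α ^ 2) * ((L : ℝ) ^ (k + 1)) ^ 2)) :
    ∀ (k : ℕ) (U₀ : Site 4 → Fin 4 → (Matrix n n ℂ)ˣ), U₀ ∈ admissible (sfClass 4 L N ε) L (k + 1) V →
      SmallField U₀ (δ / ((L : ℝ) ^ k) ^ 2) →
      ∃ U, IsMinimiser 4 (sfClass 4 L N ε) L N (k + 1) V U ∧ SmallField U (δ / ((L : ℝ) ^ (k + 1)) ^ 2) := by
  have hL1 : 1 ≤ L := by omega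
  obtain ⟨u, hu, huP, A, hAs, hAP, hAb, hchart⟩ := exists_expChart_of_sector hN hη hsec hVu hVP hVη
  have h0 : ∀ k : ℕ, ∃ U₀ : Site 4 → Fin 4 → (Matrix n n ℂ)ˣ,
      U₀ ∈ admissible (sfClass 4 L N ε) L (k + 1) (flatCfg : Site 4 → Fin 4 → (Matrix n n ℂ)ˣ) ∧ SmallField U₀ 0 :=
    fun k => ⟨flatCfg, flatCfg_mem_admissible L N hε0 (k + 1), (flat_mem_classes (d := 4) (n := n) le_rfl).2⟩
  have hWu : IsUnitaryCfg (flatCfg : Site 4 → Fin 4 → (Matrix n n ℂ)ˣ) := (flat_mem_classes (d := 4) (n := n) le_rfl).1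
  have hWP : IsPeriodicCfg (flatCfg : Site 4 → Fin 4 → (Matrix n n ℂ)ˣ) (N : ℤ) := fun _ _ _ => rfl
  have hstep' := oneStep_of_expChart_ape_rep_generic_gauge (d := 4) hL hN hε0 hε1 hε2 hδ₁ hδ₁δ hδε hCP hls 𝒯 hT hP hWu hWP hAs hAP h0
    (hape u A hu huP hAs hAP hAb hchart) (hrep u A hu huP hAs hAP hAb hchart)
  rw [← hchart] at hstep'
  exact oneStep_of_oneStep_gaugeAct hL1 hε0 hls hu huP hstep'

/-- **ONE-STEP AT `d = 4`, `L = 2`, SU(2)∕U(2) (`card n = 2`), `0 < ε ≤ 10⁻⁵³`, `0 ≤ δ₁ < δ < ε`, FOR EVERY SECTOR DATUM, FROM (APE)^path ∧ (REP^gauge over `𝒯`)^path ONLY**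
— slice `𝒯_E = energyBlockLandauW`; (hT) (`hT_energyBlockLandau`), (hP) (`classSlicePoincare_energyBlockLandau_SU2`), the level family and the class smallness discharged
(`levelSmall_all_d4_L2`, `classSmall_d4_L2`); constant of record `CP = 8·CPLine 4 2 2 10⁻¹⁷ 10⁻⁵³ + 1`. [folklore] -/
theorem oneStep_SU2_of_sector_ape_repE_gauge [Nonempty n] (hn : Fintype.card n = 2) {N : ℕ} [NeZero N] (hN : 1 ≤ N) {ε δ δ₁ η : ℝ} (hε : 0 < ε)
    (hε' : ε ≤ 1 / 10 ^ 53) (hδ₁ : 0 ≤ δ₁) (hδ₁δ : δ₁ < δ) (hδε : δ < ε) (hη : 0 ≤ η) (hsec : (Fintype.card n : ℝ) * (N : ℝ) ^ 2 * η ≤ sectorConst n)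
    {V : Site 4 → Fin 4 → (Matrix n n ℂ)ˣ} (hVu : IsUnitaryCfg V) (hVP : IsPeriodicCfg V (N : ℤ)) (hVη : SmallField V η)
    (hape : ∀ (u : Site 4 → (Matrix n n ℂ)ˣ) (A : Site 4 → Fin 4 → Matrix n n ℂ), IsUnitarySite u → IsPeriodicSite u (N : ℤ) → IsSkewDir A →
      IsPeriodicDir A (N : ℤ) → (∀ (x : Site 4) (κ : Fin 4), ‖A x κ‖ ≤ gaugeConst n * (((N : ℝ))⁻¹ + (N : ℝ) * η)) →
      gaugeAct u V = vary (flatCfg : Site 4 → Fin 4 → (Matrix n n ℂ)ˣ) A 1 →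
      ∀ (k : ℕ), ∀ τ ∈ Icc (0 : ℝ) 1, ∀ U ∈ admissible (sfClass 4 2 N ε) 2 (k + 1) (vary flatCfg (τ • A) 1),
        SmallField U (δ / ((((2 : ℕ) : ℝ)) ^ (k + 1)) ^ 2) →
        (∀ φ : Site 4 → Fin 4 → Matrix n n ℂ, IsSkewDir φ → IsPeriodicDir φ ((N * 2 ^ (k + 1) : ℕ) : ℤ) → TangentIter 2 k U φ →
          dAction U φ (perWin 4 (N * 2 ^ (k + 1))) = 0) → SmallField U (δ₁ / ((((2 : ℕ) : ℝ)) ^ (k + 1)) ^ 2))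
    (hrep : ∀ (u : Site 4 → (Matrix n n ℂ)ˣ) (A : Site 4 → Fin 4 → Matrix n n ℂ), IsUnitarySite u → IsPeriodicSite u (N : ℤ) → IsSkewDir A →
      IsPeriodicDir A (N : ℤ) → (∀ (x : Site 4) (κ : Fin 4), ‖A x κ‖ ≤ gaugeConst n * (((N : ℝ))⁻¹ + (N : ℝ) * η)) →
      gaugeAct u V = vary (flatCfg : Site 4 → Fin 4 → (Matrix n n ℂ)ˣ) A 1 →
      ∀ (k : ℕ), ∀ τ ∈ Icc (0 : ℝ) 1, ∀ Us ∈ admissible (sfClass 4 2 N ε) 2 (k + 1) (vary flatCfg (τ • A) 1),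
        SmallField Us (δ₁ / ((((2 : ℕ) : ℝ)) ^ (k + 1)) ^ 2) →
        (∀ φ : Site 4 → Fin 4 → Matrix n n ℂ, IsSkewDir φ → IsPeriodicDir φ ((N * 2 ^ (k + 1) : ℕ) : ℤ) → TangentIter 2 k Us φ →
          dAction Us φ (perWin 4 (N * 2 ^ (k + 1))) = 0) →
        ∀ U' ∈ admissible (sfClass 4 2 N ε) 2 (k + 1) (vary flatCfg (τ • A) 1), ∃ (u' : Site 4 → (Matrix n n ℂ)ˣ)
          (X XT XN : Site 4 → Fin 4 → Matrix n n ℂ) (α ν κ₁ : ℝ), IsUnitarySite u' ∧ IsSkewDir X ∧ IsPeriodicDir X ((N * 2 ^ (k + 1) : ℕ) : ℤ) ∧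
          0 ≤ α ∧ (∀ x μ, ‖X x μ‖ ≤ α) ∧ gaugeAct u' U' = vary Us X 1 ∧
          X = XT + XN ∧ XT ∈ energyBlockLandauW (d := 4) (n := n) 2 N (k + 1) Us ∧ IsSkewDir XN ∧ 0 ≤ ν ∧
          energyNormW 2 (k + 1) Us XN (periodBox (d := 4) (N * 2 ^ (k + 1)))
            ≤ ν * energyNormW 2 (k + 1) Us X (periodBox (d := 4) (N * 2 ^ (k + 1))) ∧
          ε / ((((2 : ℕ) : ℝ)) ^ (k + 1)) ^ 2 * (∑ p ∈ perWin 4 (N * 2 ^ (k + 1)), ‖curl Us XN p‖)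
            ≤ κ₁ * energyNormW 2 (k + 1) Us X (periodBox (d := 4) (N * 2 ^ (k + 1))) ^ 2 ∧
          2 * κ₁ < ((((1 / 2 - ν ^ 2) / (2 * (1 + (8 * CPLine 4 2 2 (1 / 10 ^ 17) (1 / 10 ^ 53) + 1))) - ν ^ 2) / 2
              - 576 * (4 : ℕ) * (Real.exp α - 1) ^ 2 * ((((2 : ℕ) : ℝ)) ^ (k + 1)) ^ 2) / (Fintype.card n : ℝ)
              - 28 * (4 : ℕ) * (ε / ((((2 : ℕ) : ℝ)) ^ (k + 1)) ^ 2 + 7 * α ^ 2) * ((((2 : ℕ) : ℝ)) ^ (k + 1)) ^ 2)) :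
    ∀ (k : ℕ) (U₀ : Site 4 → Fin 4 → (Matrix n n ℂ)ˣ), U₀ ∈ admissible (sfClass 4 2 N ε) 2 (k + 1) V →
      SmallField U₀ (δ / ((((2 : ℕ) : ℝ)) ^ k) ^ 2) →
      ∃ U, IsMinimiser 4 (sfClass 4 2 N ε) 2 N (k + 1) V U ∧ SmallField U (δ / ((((2 : ℕ) : ℝ)) ^ (k + 1)) ^ 2) := by
  have hCP : 0 < 8 * CPLine 4 2 2 (1 / 10 ^ 17) (1 / 10 ^ 53) + 1 := by linarith [CPLine_nonneg_d4_L2]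
  have hls := levelSmall_all_d4_L2 hε.le (hε'.trans (by norm_num))
  obtain ⟨hε1, hε2⟩ := classSmall_d4_L2 hε'
  exact oneStep_of_sector_ape_rep_generic_gauge (by norm_num) hN hε.le hε1 hε2 hδ₁ hδ₁δ hδε hCP hls
    (fun j W => energyBlockLandauW (d := 4) (n := n) 2 N (j + 1) W)
    (fun j W hW F htan => hT_energyBlockLandau (by norm_num) hε.le hls j W hW F htan)
    (fun j W hW => slicePoincare_mono (classSlicePoincare_energyBlockLandau_SU2 hn hN hε hε' j W hW) (by linarith)) hη hsec hVu hVP hVη hape hrep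

end

end Summit.QuantumFields.BalabanUV.T4Continuum.NE7OneStepGenericSliceSector
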